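import Summits.QuantumFields.YangMills.Theorems.FluctuationComparisonRegPrIntLOrganTangentFibreMeanVersionMW
import Summits.QuantumFields.YangMills.Theorems.FluctuationComparisonRegPrIntLOrganTangentAPackageDescendTo
import Summits.QuantumFields.YangMills.Theorems.FluctuationComparisonRegPrIntLRunpairOrganFibreLawDefs
import Literature.MathematicalPhysics.QuantumFieldTheory.Balaban1983to89.BalabanAdmissibleClassParams
import Literature.MathematicalPhysics.QuantumFieldTheory.Balaban1983to89.T4AveragingDisintegration
import Literature.MathematicalPhysics.QuantumFieldTheory.Balaban1983to89.T4CubeChartExp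
import HarnessLib

/-!
# Route `UnitScaleTilt` — crux `FluctuationComparisonRegPrIntL` (stmt-QuantumFields-20520, rung R3), PATH-B organ: «SPREAD-FIBRE-LAW-HJ» — DEFINITION
# (the JENSEN EDITION `SpreadFibreLawHJ` = the frozen LIN row `SpreadFibreLawH` (✓`…RunpairOrganFibreLawDefs`, v0.3m) ⊕ the Jensen letters `NV1…NV4`∕`δV1…δV4` ⊕ ONE stride conjunct (HV′);
# ★★OWNER RULINGS №72 «TN-KNIT-LANDING» (a) ∕ №73 (iii) «a further need = a NEW NAMED ROW in a new file»; LEAD w3 g26 DESIGN CALLS №32 (d) ∕ №33)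

Definitions file (route-posited object, `--kind definition`): ONE declaration, `def SpreadFibreLawHJ : Prop`, whose body is BYTE-IDENTICAL to the crux workfile
`Cruxes/FluctuationComparisonRegPrIntL/FibreLawHJ.lean` v0.2 (ideator `ym-r3-idea-1` g28, SIGNATURE d1320e128d46194c; (HV′) block by width seat `ym3-torus-px5` g20,
ws16 6b64e12142fdd076); the fibre-weight letters `mwCut` ∕ `wNum` ∕ `wgt` are NOT re-declared — they are the reviewed ones of `FluctuationComparisonRegPrIntLRunpairOrganFibreLawDefs`
(✓p812742), opened below, so that the projection `SpreadFibreLawHJ → SpreadFibreLawH` is a re-pack between two rows over the SAME constants.  Companion proof files: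
`…OrganTangentJvarHOfSpreadFibreLawJ` (the JENSEN KNIT `jvarH_of_spreadFibreLawHJ : SpreadFibreLawHJ → ⟨JVARᵘ-H″⟩`, LEAD w3 g26) and the projection (width seat px19 g20).

CONTENT of the row (one stride `j → Ts` of the cut tower; notation of the LIN row's module docstring): heads `∃ pW ∃ γ₁ ∃ κ₀`, letters `rc w₀ NT NX NL CJ NV1 NV2 NV3 NV4`, δ-triples
`δT δX δL δV1 δV2 δV3 δV4` (summable, summable tails, tail × floor → 0), `j₁`; per stride: the fibred chart `(Z, τ, Φ, J, S, π)` of `descendTo F ℰp j Ts` [0]–[11] and the (H) block [12]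
EXACTLY as in `SpreadFibreLawH`; then [12b] = (HV′) «JENSEN BRACKETS, CUMULANT FORM» for the pinned functional `h_Ts := log ρ_Ts − log ρ′_Ts`, from the same seed square clause `(k, w)`:
(JV0-h) law normalisation and square integrability — for every `t ∈ [0,1]` and window fields `X Xw`: `Integrable ŵ_t(Xw)`, `∫ ŵ_t(Xw) dτ = 1`, `Integrable (h∘Φ(X,·)·ŵ_t(Xw))`,
`Integrable ((h∘Φ(X,·))²·ŵ_t(Xw))`; (JV1-h) `∃ kV₁ ≥ 0`, κ-row-mass `≤ NV1·Dr·w·(w∕D_Ts) + δV1 j·D_j`, `∀ t ∈ [0,1]`, every coarse one-bond square `U V W Y` and window `X Xw`: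
`|∫ ΔΔ(h∘Φ)·(h∘Φ(X,·) − E_{Xw}[h∘Φ(X,·)])·ŵ_t(Xw)| ≤ kV₁ B B′·sz·sz′` (+ its `Integrable`); (JV2-h) likewise `|∫ (Δ_B(h∘Φ) − E_{Xw}Δ_B)(Δ_{B′}(h∘Φ) − E_{Xw}Δ_{B′})·ŵ_t(Xw)| ≤ kV₂…`;
(JV3-h′) the two-pair CROSS bracket (transport edge `U₁ → V₁` at `B`, law edge `U₂ → W₂` at `B′`, each covariance centred at its OWN law), row AND column mass `NV3∕δV3`;
(JV4-h′) the law square on the base observable with four own centrings, `NV4∕δV4` — all masses QUADRATIC in the seed size.  The Jensen knit reads chart + (HV′) and NOTHING of (H).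

WHAT THIS IS ∕ IS NOT.  A HYPOTHESIS ROW (XL; NOT printed as a theorem): shapes after [Balaban1987RG1] Thm 1 p.259 ∕ Thm 3 p.264 ∕ (0.22)–(0.30) (localised analytic pieces,
connected correlations of the small-field fibre laws), [Balaban1985Variational] Thm 1 p.279 ∕ Prop 9 p.309 (the chart follows the minimal lift), [Balaban1985Averaging] (10)–(13)
(disintegration along block fibres) — SOURCES of the shapes only; NOTHING of these is asserted or proved here, and no declaration below is a theorem.  Design record: (HV) v0.1's
single-centred (JV4-h) was WITHDRAWN before any tree write (px5 g20's rank-one Gaussian witness: its κ-row-mass grows like `#PBond_j`); the free-toy prices of (HV′) are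
instrument GUIDANCE only (instr-1 FL-29: `NV1 = 0`, `NV2 ≤ 1.8`, `NV3 = NV4 = 2·NV2`, m-uniform).  Crux 20520, the five registered stubs of `Lines/semiclassical_s2beta.lean`,
JVARᵘ-H″, JENᵘ-H″, O1ᵘ-H v2.2 and `YM3TorusSU2` are NOT proved by anything in this file; rung R3 = SU(2) YM₃ on T³ at fixed lattice data — NOT d = 4, NOT infinite volume,
NOT a mass gap, NOT Clay.

No `theorem`, no `instance`, no `notation`, no attribute changes; imports = the crux workfile's + the LIN DEFS file.
-/

set_option autoImplicit false

noncomputable section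

namespace Summit.QuantumFields.YangMills.Theorems.FluctuationComparisonRegPrIntLRunpairOrganFibreLawJ

open MeasureTheory Filter Topology Function
open scoped ENNReal NNReal BigOperators
open Literature.MathematicalPhysics.QuantumFieldTheory.Balaban1983to89 T3ContinuumYM3Torus T3NestedUnitLaws
  T3UnitLawDensityEML T4Continuum BalabanUVClass T3UnitScaleTilt T3LevelShift T3TiltDescent
open T4CubeChartExp (expPt)
open Summit.QuantumFields.YangMills.Theorems.FluctuationComparisonRegPrIntLRunpairOrganFibreLaw (mwCut wNum wgt)

/-- «SPREAD-FIBRE-LAW-HJ» v0.2, the JENSEN EDITION (def body byte-equal to the crux workfile `Cruxes/FluctuationComparisonRegPrIntL/FibreLawHJ.lean` v0.2) — the frozen LIN row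
`SpreadFibreLawH` (chart [0]–[11] ∧ (H) [12], same letters `mwCut`∕`wNum`∕`wgt` of `…RunpairOrganFibreLawDefs`) with the Jensen letters `NV1…NV4`, `δV1…δV4` and ONE more stride
conjunct [12b] = (HV′): (JV0-h) law normalisation + square integrability, (JV1-h)(JV2-h) transport brackets at a window law, (JV3-h′) the two-pair cross bracket (row + column mass),
(JV4-h′) the law square with four own centrings — cumulant form, t-uniform letters, quadratic masses (module docstring).  A HYPOTHESIS ROW (XL), NOT printed as a theorem — shapes
after [Balaban1987RG1] Thm 1∕Thm 3∕(0.22)–(0.30), [Balaban1985Variational] Thm 1∕Prop 9, [Balaban1985Averaging] (10)–(13), SOURCES only, nothing asserted.  Consumers: the Jensen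
knit `jvarH_of_spreadFibreLawHJ` (reads chart + (HV′) only) and the projection onto `SpreadFibreLawH`. -/
def SpreadFibreLawHJ : Prop :=
  ∃ pW : ℝ, ∃ γ₁ : ℝ, 0 < γ₁ ∧ ∀ (F : T3Family) (γ : ℝ), 0 < γ → γ ≤ γ₁ → ∀ (b₀ p₀ : ℝ) (j₀ : ℕ) (prm : ℕ → ClassParams) (η : ℕ → ℝ) (rA : ℝ) (Bρ : ℕ → ℝ), 0 < b₀ → 0 < p₀ → pW ≤ p₀ → AdmissibleClassParams F γ b₀ p₀ prm → (∀ j, 0 ≤ η j) → Summable η → Summable (fun i => ∑' k, η (k + i)) → Tendsto (fun j => (∑' k, η (k + j)) * ((1 + 2 * ((F.L : ℝ) ^ j / γ) * (Fintype.card (Plaq (F.P j) 0) : ℝ)) * (Fintype.card (PBond (F.P j) 0) : ℝ) ^ 2)) atTop (𝓝 0) → 0 < rA → ∃ κ₀ : ℝ, 0 < κ₀ ∧ ∀ (κ : ℝ), 0 < κ → κ ≤ κ₀ → ∃ (rc w₀ NT NX NL CJ NV1 NV2 NV3 NV4 : ℝ) (δT δX δL δV1 δV2 δV3 δV4 : ℕ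 → ℝ) (j₁ : ℕ), 0 < rc ∧ 0 < w₀ ∧ 0 ≤ NT ∧ 0 ≤ NX ∧ 0 ≤ NL ∧ 0 ≤ CJ ∧ (∀ n, 0 ≤ δT n ∧ 0 ≤ δX n ∧ 0 ≤ δL n) ∧ Summable δT ∧ Summable (fun i => ∑' k, δT (k + i)) ∧ Tendsto (fun j => (∑' k, δT (k + j)) * ((1 + 2 * ((F.L : ℝ) ^ j / γ) * (Fintype.card (Plaq (F.P j) 0) : ℝ)) * (Fintype.card (PBond (F.P j) 0) : ℝ) ^ 2)) atTop (𝓝 0) ∧ Summable δX ∧ Summable (fun i => ∑' k, δX (k + i)) ∧ Tendsto (fun j => (∑' k, δX (k + j)) * ((1 + 2 * ((F.L : ℝ) ^ j / γ) * (Fintype.card (Plaq (F.P j) 0) : ℝ)) * (Fintype.card (PBond (F.P j) 0) : ℝ) ^ 2)) atTop (𝓝 0) ∧ Summable δL ∧ Summable (fun i => ∑' k, δL (k + i)) ∧ Tendsto (fun j => (∑' k, δL (k + j)) * ((1 + 2 * ((F.L : ℝ) ^ j / γ) * (Fintype.card (Plaq (F.P j) 0) : ℝ)) * (Fintype.card (PBond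 (F.P j) 0) : ℝ) ^ 2)) atTop (𝓝 0) ∧ (0 ≤ NV1 ∧ 0 ≤ NV2 ∧ 0 ≤ NV3 ∧ 0 ≤ NV4 ∧ (∀ n, 0 ≤ δV1 n ∧ 0 ≤ δV2 n ∧ 0 ≤ δV3 n ∧ 0 ≤ δV4 n) ∧ (Summable δV1 ∧ Summable (fun i => ∑' k, δV1 (k + i)) ∧ Tendsto (fun j => (∑' k, δV1 (k + j)) * ((1 + 2 * ((F.L : ℝ) ^ j / γ) * (Fintype.card (Plaq (F.P j) 0) : ℝ)) * (Fintype.card (PBond (F.P j) 0) : ℝ) ^ 2)) atTop (𝓝 0)) ∧ (Summable δV2 ∧ Summable (fun i => ∑' k, δV2 (k + i)) ∧ Tendsto (fun j => (∑' k, δV2 (k + j)) * ((1 + 2 * ((F.L : ℝ) ^ j / γ) * (Fintype.card (Plaq (F.P j) 0) : ℝ)) * (Fintype.card (PBond (F.P j) 0) : ℝ) ^ 2)) atTop (𝓝 0)) ∧ (Summable δV3 ∧ Summable (fun i => ∑' k, δV3 (k + i)) ∧ Tendsto (fun j => (∑' k, δV3 (k + j)) * ((1 + 2 * ((F.L : ℝ)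 ^ j / γ) * (Fintype.card (Plaq (F.P j) 0) : ℝ)) * (Fintype.card (PBond (F.P j) 0) : ℝ) ^ 2)) atTop (𝓝 0)) ∧ (Summable δV4 ∧ Summable (fun i => ∑' k, δV4 (k + i)) ∧ Tendsto (fun j => (∑' k, δV4 (k + j)) * ((1 + 2 * ((F.L : ℝ) ^ j / γ) * (Fintype.card (Plaq (F.P j) 0) : ℝ)) * (Fintype.card (PBond (F.P j) 0) : ℝ) ^ 2)) atTop (𝓝 0))) ∧ j₀ ≤ j₁ ∧ ∀ (ν : ℕ → (j : ℕ) → MeasureTheory.Measure (GaugeField (F.P j) 0 ↥(Matrix.specialUnitaryGroup (Fin 2) ℂ))), (∀ K, ν K K = T4GenFunBounds.gibbsMeasure (F.P K) ((F.scheme ℰp γ).β K)) → (∀ K j, j < K → ν K j = Measure.map (descend F ℰp j) (ν K (j + 1))) → ∀ (K K' : ℕ), K ≤ K' → ∀ (Ts T : ℕ), Ts < T → T ≤ K → ∀ (μ μ' : ((j : ℕ) → MeasureTheory.Measure (GaugeField (F.P j) 0 ↥(Matrix.specialUnitaryGroup (Fin 2) ℂ)))) (ρ ρ' : ((j : ℕ)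 → GaugeField (F.P j) 0 ↥(Matrix.specialUnitaryGroup (Fin 2) ℂ) → ℝ)), (∀ j : ℕ, Ts ≤ j → j ≤ T → μ j = ν K j ∧ μ' j = ν K' j) → (∀ j : ℕ, j < Ts → μ j = Measure.map (descend F ℰp j) ((μ (j + 1)).withDensity (fun U => ENNReal.ofReal ((∏ p : Plaq _ _, max 0 (min 1 ((24 / 25 * (θBal F.L γ b₀ p₀ (j + 1)) - dist1 (GaugeField.plaqHol U p)) / ((24 / 25 - 1 / 2) * (θBal F.L γ b₀ p₀ (j + 1))))))))) ∧ μ' j = Measure.map (descend F ℰp j) ((μ' (j + 1)).withDensity (fun U => ENNReal.ofReal ((∏ p : Plaq _ _, max 0 (min 1 ((24 / 25 * (θBal F.L γ b₀ p₀ (j + 1)) - dist1 (GaugeField.plaqHol U p)) / ((24 / 25 - 1 / 2) * (θBal F.L γ b₀ p₀ (j + 1)))))))))) → (∀ j : ℕ, Ts ≤ j → j < T → μ j = Measure.map (descend F ℰp j) (μ (j + 1)) ∧ μ' j = Measure.map (descend F ℰp j) (μ' (j + 1))) → (∀ j : ℕ, j ≤ T → IsFiniteMeasure (μ j) ∧ IsFiniteMeasure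 (μ' j)) → (∀ j : ℕ, j₀ ≤ j → j ≤ T → ((∀ U, PlaqSmall (θBal F.L γ b₀ p₀ j) U → 0 < ρ j U ∧ 0 < ρ' j U) ∧ μ j = (fieldMeasure _ _ _).withDensity (fun U => ENNReal.ofReal (ρ j U)) ∧ μ' j = (fieldMeasure _ _ _).withDensity (fun U => ENNReal.ofReal (ρ' j U)) ∧ (∃ κ : ℝ, MemAtHeight F ℰp j (prm j) (fun U => Real.exp κ * ρ j U)) ∧ (∃ κ : ℝ, MemAtHeight F ℰp j (prm j) (fun U => Real.exp κ * ρ' j U)) ∧ μ j {U | ¬ PlaqSmall (θBal F.L γ b₀ p₀ j) U} ≤ ENNReal.ofReal (η j) ∧ μ' j {U | ¬ PlaqSmall (θBal F.L γ b₀ p₀ j) U} ≤ ENNReal.ofReal (η j) ∧ (ContinuousOn (ρ j) {U | PlaqSmall (θBal F.L γ b₀ p₀ j) U} ∧ ContinuousOn (ρ' j) {U | PlaqSmall (θBal F.L γ b₀ p₀ j) U}) ∧ ((∀ (U : GaugeField _ _ ↥(Matrix.specialUnitaryGroup (Fin 2) ℂ)), PlaqSmall (49 / 50 * θBal F.L γ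 b₀ p₀ j) U → ∀ (b b' : PBond _ _) (v v' : Fin 3 → ℝ), ‖v‖ ≤ 1 → ‖v'‖ ≤ 1 → ∃ g : ℂ × ℂ → ℂ, DifferentiableOn ℂ g (Metric.ball (0 : ℂ) (rA * (49 / 50 * θBal F.L γ b₀ p₀ j)) ×ˢ Metric.ball (0 : ℂ) (rA * (49 / 50 * θBal F.L γ b₀ p₀ j))) ∧ (∀ (s t : ℝ) (V Z : GaugeField _ _ ↥(Matrix.specialUnitaryGroup (Fin 2) ℂ)), |s| < rA * (49 / 50 * θBal F.L γ b₀ p₀ j) → |t| < rA * (49 / 50 * θBal F.L γ b₀ p₀ j) → (∀ e, e ≠ b → V e = U e) → V b = U b * expPt (s • v) → (∀ e, e ≠ b' → Z e = V e) → Z b' = V b' * expPt (t • v') → g ((s : ℂ), (t : ℂ)) = (((Real.log (ρ j Z)) : ℝ) : ℂ)) ∧ ∀ z ∈ Metric.ball (0 : ℂ) (rA * (49 / 50 * θBal F.L γ b₀ p₀ j)) ×ˢ Metric.ball (0 : ℂ) (rA * (49 / 50 * θBal F.L γ b₀ p₀ j)), ‖g z - g 0‖ ≤ (Bρ j)) ∧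 (∀ (U : GaugeField _ _ ↥(Matrix.specialUnitaryGroup (Fin 2) ℂ)), PlaqSmall (49 / 50 * θBal F.L γ b₀ p₀ j) U → ∀ (b b' : PBond _ _) (v v' : Fin 3 → ℝ), ‖v‖ ≤ 1 → ‖v'‖ ≤ 1 → ∃ g : ℂ × ℂ → ℂ, DifferentiableOn ℂ g (Metric.ball (0 : ℂ) (rA * (49 / 50 * θBal F.L γ b₀ p₀ j)) ×ˢ Metric.ball (0 : ℂ) (rA * (49 / 50 * θBal F.L γ b₀ p₀ j))) ∧ (∀ (s t : ℝ) (V Z : GaugeField _ _ ↥(Matrix.specialUnitaryGroup (Fin 2) ℂ)), |s| < rA * (49 / 50 * θBal F.L γ b₀ p₀ j) → |t| < rA * (49 / 50 * θBal F.L γ b₀ p₀ j) → (∀ e, e ≠ b → V e = U e) → V b = U b * expPt (s • v) → (∀ e, e ≠ b' → Z e = V e) → Z b' = V b' * expPt (t • v') → g ((s : ℂ), (t : ℂ)) = (((Real.log (ρ' j Z)) : ℝ) : ℂ)) ∧ ∀ z ∈ Metric.ball (0 : ℂ) (rA * (49 / 50 * θBal F.L γ b₀ p₀ j)) ×ˢ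 Metric.ball (0 : ℂ) (rA * (49 / 50 * θBal F.L γ b₀ p₀ j)), ‖g z - g 0‖ ≤ (Bρ j))))) → ∀ (j : ℕ), j₁ ≤ j → ∀ (hjTs : j + 1 ≤ Ts), ∃ (Z : Type) (_ : MeasurableSpace Z) (τ : MeasureTheory.Measure Z) (Φ : GaugeField (F.P j) 0 ↥(Matrix.specialUnitaryGroup (Fin 2) ℂ) × Z → GaugeField (F.P Ts) 0 ↥(Matrix.specialUnitaryGroup (Fin 2) ℂ)) (J : GaugeField (F.P j) 0 ↥(Matrix.specialUnitaryGroup (Fin 2) ℂ) × Z → NNReal) (S : Set (GaugeField (F.P Ts) 0 ↥(Matrix.specialUnitaryGroup (Fin 2) ℂ))) (π : Site (F.P Ts) 0 → Site (F.P j) 0), MeasureTheory.IsProbabilityMeasure τ ∧ Measurable Φ ∧ Measurable J ∧ MeasurableSet S ∧ (∀ U : GaugeField (F.P Ts) 0 ↥(Matrix.specialUnitaryGroup (Fin 2) ℂ), (∀ (n : ℕ) (hjn : j + 1 ≤ n) (hnK : n ≤ Ts), PlaqSmall (24 / 25 * θBal F.L γ b₀ p₀ n) (descendTo F ℰp n Ts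 hnK U)) → U ∈ S) ∧ (∀ V z, descendTo F ℰp j Ts (Nat.le_of_succ_le hjTs) (Φ (V, z)) = V) ∧ (∀ A : Set (GaugeField (F.P j) 0 ↥(Matrix.specialUnitaryGroup (Fin 2) ℂ)), MeasurableSet A → (fieldMeasure (F.P Ts) 0 ↥(Matrix.specialUnitaryGroup (Fin 2) ℂ)).restrict (descendTo F ℰp j Ts (Nat.le_of_succ_le hjTs) ⁻¹' A ∩ S) = ((((fieldMeasure (F.P j) 0 ↥(Matrix.specialUnitaryGroup (Fin 2) ℂ)).restrict A).prod τ).withDensity (fun p => (J p : ENNReal))).map Φ) ∧ (∀ f : GaugeField (F.P Ts) 0 ↥(Matrix.specialUnitaryGroup (Fin 2) ℂ) → ℝ, Continuous f → (∀ U, f U ≠ 0 → (∀ (n : ℕ) (hjn : j + 1 ≤ n) (hnK : n ≤ Ts), PlaqSmall (24 / 25 * θBal F.L γ b₀ p₀ n) (descendTo F ℰp n Ts hnK U))) → ∀ z, ContinuousOn (fun V => (J (V, z) : ℝ) * f (Φ (V, z))) {V | PlaqSmall (θBal F.L γ b₀ p₀ j) V}) ∧ (∀ V z, (J (V, z) :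 ℝ) ≤ CJ) ∧ (∀ V, PlaqSmall (θBal F.L γ b₀ p₀ j) V → 0 < ∫⁻ z in {z | (∀ (n : ℕ) (hjn : j + 1 ≤ n) (hnK : n ≤ Ts), PlaqSmall (24 / 25 * θBal F.L γ b₀ p₀ n) (descendTo F ℰp n Ts hnK (Φ (V, z))))}, (J (V, z) : ENNReal) ∂τ) ∧ (∀ x y : Site (F.P Ts) 0, (((π x).tdist (π y) : ℕ) : ℝ) ≤ ((x.tdist y : ℕ) : ℝ)) ∧ (∀ y : Site (F.P j) 0, ∃ s : Finset (Site (F.P Ts) 0), (∀ x, π x = y → x ∈ s) ∧ (s.card : ℝ) ≤ ((F.L : ℝ) ^ (Ts - j)) ^ 3) ∧ (∀ (k : PBond (F.P Ts) 0 → PBond (F.P Ts) 0 → ℝ) (w : ℝ), 0 ≤ w → w / (((F.L : ℝ) ^ Ts / γ) * θBal F.L γ b₀ p₀ Ts ^ 2) ≤ w₀ → (∀ b b', 0 ≤ k b b') → (∀ b, ∑ b', k b b' * Real.exp (κ * (b.src.tdist b'.src : ℝ)) ≤ w) → (∀ (b b' : PBond (F.P Ts) 0) (v v' : Fin 3 →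 ℝ) (U V W Y : GaugeField (F.P Ts) 0 ↥(Matrix.specialUnitaryGroup (Fin 2) ℂ)), ‖v‖ ≤ (rA / 2) * (θBal F.L γ b₀ p₀ Ts / 4) → ‖v'‖ ≤ (rA / 2) * (θBal F.L γ b₀ p₀ Ts / 4) → PlaqSmall (θBal F.L γ b₀ p₀ Ts / 4) U → PlaqSmall (θBal F.L γ b₀ p₀ Ts / 4) V → PlaqSmall (θBal F.L γ b₀ p₀ Ts / 4) W → PlaqSmall (θBal F.L γ b₀ p₀ Ts / 4) Y → (∀ e, e ≠ b → V e = U e) → V b = U b * expPt v → (∀ e, e ≠ b' → W e = U e) → W b' = U b' * expPt v' → (∀ e, e ≠ b' → Y e = V e) → Y b' = V b' * expPt v' → |(Real.log (ρ Ts Y) - Real.log (ρ' Ts Y)) - (Real.log (ρ Ts V) - Real.log (ρ' Ts V)) - (Real.log (ρ Ts W) - Real.log (ρ' Ts W)) + (Real.log (ρ Ts U) - Real.log (ρ' Ts U))| ≤ k b b' * (‖v‖ / (θBal F.L γ b₀ p₀ Ts / 4)) * (‖v'‖ / (θBal F.L γ b₀ p₀ Ts / 4))) → (∀ t : ℝ,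 0 ≤ t → t ≤ 1 → ∃ k' : PBond (F.P j) 0 → PBond (F.P j) 0 → ℝ, (∀ B B', 0 ≤ k' B B') ∧ (∀ B, ∑ B', k' B B' * Real.exp (κ * (B.src.tdist B'.src : ℝ)) ≤ NT * ((((F.L : ℝ) ^ j / γ) * θBal F.L γ b₀ p₀ j ^ 2) / (((F.L : ℝ) ^ Ts / γ) * θBal F.L γ b₀ p₀ Ts ^ 2)) * w + δT j * (((F.L : ℝ) ^ j / γ) * θBal F.L γ b₀ p₀ j ^ 2)) ∧ (∀ (B B' : PBond (F.P j) 0) (m m' : Fin 3 → ℝ) (U V W Y Xw : GaugeField (F.P j) 0 ↥(Matrix.specialUnitaryGroup (Fin 2) ℂ)), ‖m‖ ≤ rc * (θBal F.L γ b₀ p₀ j / 4) → ‖m'‖ ≤ rc * (θBal F.L γ b₀ p₀ j / 4) → PlaqSmall (θBal F.L γ b₀ p₀ j / 4) U → PlaqSmall (θBal F.L γ b₀ p₀ j / 4) V → PlaqSmall (θBal F.L γ b₀ p₀ j / 4) W → PlaqSmall (θBal F.L γ b₀ p₀ j / 4) Y → PlaqSmall (θBal F.L γ b₀ p₀ j /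 4) Xw → (∀ e, e ≠ B → V e = U e) → V B = U B * expPt m → (∀ e, e ≠ B' → W e = U e) → W B' = U B' * expPt m' → (∀ e, e ≠ B' → Y e = V e) → Y B' = V B' * expPt m' → Integrable (fun z => (Real.log (ρ Ts (Φ (U, z))) - Real.log (ρ' Ts (Φ (U, z)))) * (wgt F γ b₀ p₀ j Ts ρ ρ' τ Φ J t) Xw z) τ ∧ Integrable (fun z => (Real.log (ρ Ts (Φ (V, z))) - Real.log (ρ' Ts (Φ (V, z)))) * (wgt F γ b₀ p₀ j Ts ρ ρ' τ Φ J t) Xw z) τ ∧ Integrable (fun z => (Real.log (ρ Ts (Φ (W, z))) - Real.log (ρ' Ts (Φ (W, z)))) * (wgt F γ b₀ p₀ j Ts ρ ρ' τ Φ J t) Xw z) τ ∧ Integrable (fun z => (Real.log (ρ Ts (Φ (Y, z))) - Real.log (ρ' Ts (Φ (Y, z)))) * (wgt F γ b₀ p₀ j Ts ρ ρ' τ Φ J t) Xw z) τ ∧ |∫ z, ((Real.log (ρ Ts (Φ (Y, z))) - Real.log (ρ' Ts (Φ (Y, z)))) - (Real.log (ρ Ts (Φ (V, z))) - Real.log (ρ'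 Ts (Φ (V, z)))) - (Real.log (ρ Ts (Φ (W, z))) - Real.log (ρ' Ts (Φ (W, z)))) + (Real.log (ρ Ts (Φ (U, z))) - Real.log (ρ' Ts (Φ (U, z))))) * (wgt F γ b₀ p₀ j Ts ρ ρ' τ Φ J t) Xw z ∂τ| ≤ k' B B' * (‖m‖ / (θBal F.L γ b₀ p₀ j / 4)) * (‖m'‖ / (θBal F.L γ b₀ p₀ j / 4)))) ∧ (∀ t : ℝ, 0 ≤ t → t ≤ 1 → ∃ kX : PBond (F.P j) 0 → PBond (F.P j) 0 → ℝ, (∀ B B', 0 ≤ kX B B') ∧ (∀ B, ∑ B', kX B B' * Real.exp (κ * (B.src.tdist B'.src : ℝ)) ≤ NX * ((((F.L : ℝ) ^ j / γ) * θBal F.L γ b₀ p₀ j ^ 2) / (((F.L : ℝ) ^ Ts / γ) * θBal F.L γ b₀ p₀ Ts ^ 2)) * w + δX j * (((F.L : ℝ) ^ j / γ) * θBal F.L γ b₀ p₀ j ^ 2)) ∧ (∀ B', ∑ B, kX B B' * Real.exp (κ * (B.src.tdist B'.src : ℝ)) ≤ NX * ((((F.L : ℝ) ^ j / γ) * θBal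 F.L γ b₀ p₀ j ^ 2) / (((F.L : ℝ) ^ Ts / γ) * θBal F.L γ b₀ p₀ Ts ^ 2)) * w + δX j * (((F.L : ℝ) ^ j / γ) * θBal F.L γ b₀ p₀ j ^ 2)) ∧ (∀ (B B' : PBond (F.P j) 0) (m m' : Fin 3 → ℝ) (U₁ V₁ U₂ W₂ : GaugeField (F.P j) 0 ↥(Matrix.specialUnitaryGroup (Fin 2) ℂ)), ‖m‖ ≤ rc * (θBal F.L γ b₀ p₀ j / 4) → ‖m'‖ ≤ rc * (θBal F.L γ b₀ p₀ j / 4) → PlaqSmall (θBal F.L γ b₀ p₀ j / 4) U₁ → PlaqSmall (θBal F.L γ b₀ p₀ j / 4) V₁ → PlaqSmall (θBal F.L γ b₀ p₀ j / 4) U₂ → PlaqSmall (θBal F.L γ b₀ p₀ j / 4) W₂ → (∀ e, e ≠ B → V₁ e = U₁ e) → V₁ B = U₁ B * expPt m → (∀ e, e ≠ B' → W₂ e = U₂ e) → W₂ B' = U₂ B' * expPt m' → Integrable (fun z => (Real.log (ρ Ts (Φ (U₁, z))) - Real.log (ρ' Ts (Φ (U₁, z)))) * (wgt F γ b₀ p₀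 j Ts ρ ρ' τ Φ J t) U₂ z) τ ∧ Integrable (fun z => (Real.log (ρ Ts (Φ (V₁, z))) - Real.log (ρ' Ts (Φ (V₁, z)))) * (wgt F γ b₀ p₀ j Ts ρ ρ' τ Φ J t) U₂ z) τ ∧ Integrable (fun z => (Real.log (ρ Ts (Φ (U₁, z))) - Real.log (ρ' Ts (Φ (U₁, z)))) * (wgt F γ b₀ p₀ j Ts ρ ρ' τ Φ J t) W₂ z) τ ∧ Integrable (fun z => (Real.log (ρ Ts (Φ (V₁, z))) - Real.log (ρ' Ts (Φ (V₁, z)))) * (wgt F γ b₀ p₀ j Ts ρ ρ' τ Φ J t) W₂ z) τ ∧ |((∫ z, (Real.log (ρ Ts (Φ (V₁, z))) - Real.log (ρ' Ts (Φ (V₁, z)))) * (wgt F γ b₀ p₀ j Ts ρ ρ' τ Φ J t) W₂ z ∂τ) - (∫ z, (Real.log (ρ Ts (Φ (U₁, z))) - Real.log (ρ' Ts (Φ (U₁, z)))) * (wgt F γ b₀ p₀ j Ts ρ ρ' τ Φ J t) W₂ z ∂τ)) - ((∫ z, (Real.log (ρ Ts (Φ (V₁, z))) - Real.log (ρ' Ts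 (Φ (V₁, z)))) * (wgt F γ b₀ p₀ j Ts ρ ρ' τ Φ J t) U₂ z ∂τ) - (∫ z, (Real.log (ρ Ts (Φ (U₁, z))) - Real.log (ρ' Ts (Φ (U₁, z)))) * (wgt F γ b₀ p₀ j Ts ρ ρ' τ Φ J t) U₂ z ∂τ))| ≤ kX B B' * (‖m‖ / (θBal F.L γ b₀ p₀ j / 4)) * (‖m'‖ / (θBal F.L γ b₀ p₀ j / 4)))) ∧ (∀ t : ℝ, 0 ≤ t → t ≤ 1 → ∃ kL : PBond (F.P j) 0 → PBond (F.P j) 0 → ℝ, (∀ B B', 0 ≤ kL B B') ∧ (∀ B, ∑ B', kL B B' * Real.exp (κ * (B.src.tdist B'.src : ℝ)) ≤ NL * ((((F.L : ℝ) ^ j / γ) * θBal F.L γ b₀ p₀ j ^ 2) / (((F.L : ℝ) ^ Ts / γ) * θBal F.L γ b₀ p₀ Ts ^ 2)) * w + δL j * (((F.L : ℝ) ^ j / γ) * θBal F.L γ b₀ p₀ j ^ 2)) ∧ (∀ (B B' : PBond (F.P j) 0) (m m' : Fin 3 → ℝ) (V00 V10 V01 V11 : GaugeField (F.P j) 0 ↥(Matrix.specialUnitaryGroup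 (Fin 2) ℂ)), ‖m‖ ≤ rc * (θBal F.L γ b₀ p₀ j / 4) → ‖m'‖ ≤ rc * (θBal F.L γ b₀ p₀ j / 4) → PlaqSmall (θBal F.L γ b₀ p₀ j / 4) V00 → PlaqSmall (θBal F.L γ b₀ p₀ j / 4) V10 → PlaqSmall (θBal F.L γ b₀ p₀ j / 4) V01 → PlaqSmall (θBal F.L γ b₀ p₀ j / 4) V11 → (∀ e, e ≠ B → V10 e = V00 e) → V10 B = V00 B * expPt m → (∀ e, e ≠ B' → V01 e = V00 e) → V01 B' = V00 B' * expPt m' → (∀ e, e ≠ B' → V11 e = V10 e) → V11 B' = V10 B' * expPt m' → Integrable (fun z => (Real.log (ρ Ts (Φ (V00, z))) - Real.log (ρ' Ts (Φ (V00, z)))) * (wgt F γ b₀ p₀ j Ts ρ ρ' τ Φ J t) V00 z) τ ∧ Integrable (fun z => (Real.log (ρ Ts (Φ (V00, z))) - Real.log (ρ' Ts (Φ (V00, z)))) * (wgt F γ b₀ p₀ j Ts ρ ρ' τ Φ J t) V10 z) τ ∧ Integrable (fun z => (Real.log (ρ Ts (Φ (V00, z))) - Real.log (ρ' Ts (Φ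 (V00, z)))) * (wgt F γ b₀ p₀ j Ts ρ ρ' τ Φ J t) V01 z) τ ∧ Integrable (fun z => (Real.log (ρ Ts (Φ (V00, z))) - Real.log (ρ' Ts (Φ (V00, z)))) * (wgt F γ b₀ p₀ j Ts ρ ρ' τ Φ J t) V11 z) τ ∧ |(∫ z, (Real.log (ρ Ts (Φ (V00, z))) - Real.log (ρ' Ts (Φ (V00, z)))) * (wgt F γ b₀ p₀ j Ts ρ ρ' τ Φ J t) V11 z ∂τ) - (∫ z, (Real.log (ρ Ts (Φ (V00, z))) - Real.log (ρ' Ts (Φ (V00, z)))) * (wgt F γ b₀ p₀ j Ts ρ ρ' τ Φ J t) V10 z ∂τ) - (∫ z, (Real.log (ρ Ts (Φ (V00, z))) - Real.log (ρ' Ts (Φ (V00, z)))) * (wgt F γ b₀ p₀ j Ts ρ ρ' τ Φ J t) V01 z ∂τ) + (∫ z, (Real.log (ρ Ts (Φ (V00, z))) - Real.log (ρ' Ts (Φ (V00, z)))) * (wgt F γ b₀ p₀ j Ts ρ ρ' τ Φ J t) V00 z ∂τ)| ≤ kL B B' * (‖m‖ / (θBal F.L γ b₀ p₀ j / 4)) *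 (‖m'‖ / (θBal F.L γ b₀ p₀ j / 4))))) ∧ (∀ (k : PBond (F.P Ts) 0 → PBond (F.P Ts) 0 → ℝ) (w : ℝ), 0 ≤ w → w / (((F.L : ℝ) ^ Ts / γ) * θBal F.L γ b₀ p₀ Ts ^ 2) ≤ w₀ → (∀ b b', 0 ≤ k b b') → (∀ b, ∑ b', k b b' * Real.exp (κ * (b.src.tdist b'.src : ℝ)) ≤ w) → (∀ (b b' : PBond (F.P Ts) 0) (v v' : Fin 3 → ℝ) (U V W Y : GaugeField (F.P Ts) 0 ↥(Matrix.specialUnitaryGroup (Fin 2) ℂ)), ‖v‖ ≤ (rA / 2) * (θBal F.L γ b₀ p₀ Ts / 4) → ‖v'‖ ≤ (rA / 2) * (θBal F.L γ b₀ p₀ Ts / 4) → PlaqSmall (θBal F.L γ b₀ p₀ Ts / 4) U → PlaqSmall (θBal F.L γ b₀ p₀ Ts / 4) V → PlaqSmall (θBal F.L γ b₀ p₀ Ts / 4) W → PlaqSmall (θBal F.L γ b₀ p₀ Ts / 4) Y → (∀ e, e ≠ b → V e = U e) → V b = U b * expPt v → (∀ e, e ≠ b' → W e = U e) → W b' = U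 b' * expPt v' → (∀ e, e ≠ b' → Y e = V e) → Y b' = V b' * expPt v' → |(Real.log (ρ Ts Y) - Real.log (ρ' Ts Y)) - (Real.log (ρ Ts V) - Real.log (ρ' Ts V)) - (Real.log (ρ Ts W) - Real.log (ρ' Ts W)) + (Real.log (ρ Ts U) - Real.log (ρ' Ts U))| ≤ k b b' * (‖v‖ / (θBal F.L γ b₀ p₀ Ts / 4)) * (‖v'‖ / (θBal F.L γ b₀ p₀ Ts / 4))) →
(∀ t : ℝ, 0 ≤ t → t ≤ 1 → ∀ (X Xw : GaugeField (F.P j) 0 ↥(Matrix.specialUnitaryGroup (Fin 2) ℂ)), PlaqSmall (θBal F.L γ b₀ p₀ j / 4) X → PlaqSmall (θBal F.L γ b₀ p₀ j / 4) Xw → Integrable (fun z => (wgt F γ b₀ p₀ j Ts ρ ρ' τ Φ J t) Xw z) τ ∧ ∫ z, (wgt F γ b₀ p₀ j Ts ρ ρ' τ Φ J t) Xw z ∂τ = 1 ∧ Integrable (fun z => (Real.log (ρ Ts (Φ (X, z))) - Real.log (ρ' Ts (Φ (X, z)))) * (wgt F γ b₀ p₀ j Ts ρ ρ' τ Φ J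 t) Xw z) τ ∧ Integrable (fun z => (Real.log (ρ Ts (Φ (X, z))) - Real.log (ρ' Ts (Φ (X, z)))) ^ 2 * (wgt F γ b₀ p₀ j Ts ρ ρ' τ Φ J t) Xw z) τ)
∧ (∃ kV₁ : PBond (F.P j) 0 → PBond (F.P j) 0 → ℝ, (∀ B B', 0 ≤ kV₁ B B') ∧ (∀ B, ∑ B', kV₁ B B' * Real.exp (κ * (B.src.tdist B'.src : ℝ)) ≤ NV1 * ((((F.L : ℝ) ^ j / γ) * θBal F.L γ b₀ p₀ j ^ 2) / (((F.L : ℝ) ^ Ts / γ) * θBal F.L γ b₀ p₀ Ts ^ 2)) * w * (w / (((F.L : ℝ) ^ Ts / γ) * θBal F.L γ b₀ p₀ Ts ^ 2)) + δV1 j * (((F.L : ℝ) ^ j / γ) * θBal F.L γ b₀ p₀ j ^ 2)) ∧ ∀ t : ℝ, 0 ≤ t → t ≤ 1 → (∀ (B B' : PBond (F.P j) 0) (m m' : Fin 3 → ℝ) (U V W Y X Xw : GaugeField (F.P j) 0 ↥(Matrix.specialUnitaryGroup (Fin 2) ℂ)), ‖m‖ ≤ rc * (θBal F.L γ b₀ p₀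 j / 4) → ‖m'‖ ≤ rc * (θBal F.L γ b₀ p₀ j / 4) → PlaqSmall (θBal F.L γ b₀ p₀ j / 4) U → PlaqSmall (θBal F.L γ b₀ p₀ j / 4) V → PlaqSmall (θBal F.L γ b₀ p₀ j / 4) W → PlaqSmall (θBal F.L γ b₀ p₀ j / 4) Y → PlaqSmall (θBal F.L γ b₀ p₀ j / 4) X → PlaqSmall (θBal F.L γ b₀ p₀ j / 4) Xw → (∀ e, e ≠ B → V e = U e) → V B = U B * expPt m → (∀ e, e ≠ B' → W e = U e) → W B' = U B' * expPt m' → (∀ e, e ≠ B' → Y e = V e) → Y B' = V B' * expPt m' → ∀ (c : ℝ), c = ∫ z, (Real.log (ρ Ts (Φ (X, z))) - Real.log (ρ' Ts (Φ (X, z)))) * (wgt F γ b₀ p₀ j Ts ρ ρ' τ Φ J t) Xw z ∂τ → Integrable (fun z => ((Real.log (ρ Ts (Φ (Y, z))) - Real.log (ρ' Ts (Φ (Y, z)))) - (Real.log (ρ Ts (Φ (V, z))) - Real.log (ρ' Ts (Φ (V, z)))) - (Real.log (ρ Ts (Φ (W, z))) - Real.log (ρ' Ts (Φ (W, z)))) +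 (Real.log (ρ Ts (Φ (U, z))) - Real.log (ρ' Ts (Φ (U, z))))) * ((Real.log (ρ Ts (Φ (X, z))) - Real.log (ρ' Ts (Φ (X, z)))) - c) * (wgt F γ b₀ p₀ j Ts ρ ρ' τ Φ J t) Xw z) τ ∧ |∫ z, ((Real.log (ρ Ts (Φ (Y, z))) - Real.log (ρ' Ts (Φ (Y, z)))) - (Real.log (ρ Ts (Φ (V, z))) - Real.log (ρ' Ts (Φ (V, z)))) - (Real.log (ρ Ts (Φ (W, z))) - Real.log (ρ' Ts (Φ (W, z)))) + (Real.log (ρ Ts (Φ (U, z))) - Real.log (ρ' Ts (Φ (U, z))))) * ((Real.log (ρ Ts (Φ (X, z))) - Real.log (ρ' Ts (Φ (X, z)))) - c) * (wgt F γ b₀ p₀ j Ts ρ ρ' τ Φ J t) Xw z ∂τ| ≤ kV₁ B B' * (‖m‖ / (θBal F.L γ b₀ p₀ j / 4)) * (‖m'‖ / (θBal F.L γ b₀ p₀ j / 4))))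
∧ (∃ kV₂ : PBond (F.P j) 0 → PBond (F.P j) 0 → ℝ, (∀ B B', 0 ≤ kV₂ B B') ∧ (∀ B, ∑ B', kV₂ B B' * Real.exp (κ * (B.src.tdist B'.src : ℝ)) ≤ NV2 * ((((F.L : ℝ) ^ j / γ) * θBal F.L γ b₀ p₀ j ^ 2) / (((F.L : ℝ) ^ Ts / γ) * θBal F.L γ b₀ p₀ Ts ^ 2)) * w * (w / (((F.L : ℝ) ^ Ts / γ) * θBal F.L γ b₀ p₀ Ts ^ 2)) + δV2 j * (((F.L : ℝ) ^ j / γ) * θBal F.L γ b₀ p₀ j ^ 2)) ∧ ∀ t : ℝ, 0 ≤ t → t ≤ 1 → (∀ (B B' : PBond (F.P j) 0) (m m' : Fin 3 → ℝ) (U V W Y Xw : GaugeField (F.P j) 0 ↥(Matrix.specialUnitaryGroup (Fin 2) ℂ)), ‖m‖ ≤ rc * (θBal F.L γ b₀ p₀ j / 4) → ‖m'‖ ≤ rc * (θBal F.L γ b₀ p₀ j / 4) → PlaqSmall (θBal F.L γ b₀ p₀ j / 4) U → PlaqSmall (θBal F.L γ b₀ p₀ j / 4) V → PlaqSmall (θBal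 F.L γ b₀ p₀ j / 4) W → PlaqSmall (θBal F.L γ b₀ p₀ j / 4) Y → PlaqSmall (θBal F.L γ b₀ p₀ j / 4) Xw → (∀ e, e ≠ B → V e = U e) → V B = U B * expPt m → (∀ e, e ≠ B' → W e = U e) → W B' = U B' * expPt m' → (∀ e, e ≠ B' → Y e = V e) → Y B' = V B' * expPt m' → ∀ (c₁ c₂ : ℝ), c₁ = ∫ z, ((Real.log (ρ Ts (Φ (V, z))) - Real.log (ρ' Ts (Φ (V, z)))) - (Real.log (ρ Ts (Φ (U, z))) - Real.log (ρ' Ts (Φ (U, z))))) * (wgt F γ b₀ p₀ j Ts ρ ρ' τ Φ J t) Xw z ∂τ → c₂ = ∫ z, ((Real.log (ρ Ts (Φ (W, z))) - Real.log (ρ' Ts (Φ (W, z)))) - (Real.log (ρ Ts (Φ (U, z))) - Real.log (ρ' Ts (Φ (U, z))))) * (wgt F γ b₀ p₀ j Ts ρ ρ' τ Φ J t) Xw z ∂τ → Integrable (fun z => (((Real.log (ρ Ts (Φ (V, z))) - Real.log (ρ' Ts (Φ (V, z)))) - (Real.log (ρ Ts (Φ (U, z))) - Real.log (ρ' Ts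 (Φ (U, z))))) - c₁) * (((Real.log (ρ Ts (Φ (W, z))) - Real.log (ρ' Ts (Φ (W, z)))) - (Real.log (ρ Ts (Φ (U, z))) - Real.log (ρ' Ts (Φ (U, z))))) - c₂) * (wgt F γ b₀ p₀ j Ts ρ ρ' τ Φ J t) Xw z) τ ∧ |∫ z, (((Real.log (ρ Ts (Φ (V, z))) - Real.log (ρ' Ts (Φ (V, z)))) - (Real.log (ρ Ts (Φ (U, z))) - Real.log (ρ' Ts (Φ (U, z))))) - c₁) * (((Real.log (ρ Ts (Φ (W, z))) - Real.log (ρ' Ts (Φ (W, z)))) - (Real.log (ρ Ts (Φ (U, z))) - Real.log (ρ' Ts (Φ (U, z))))) - c₂) * (wgt F γ b₀ p₀ j Ts ρ ρ' τ Φ J t) Xw z ∂τ| ≤ kV₂ B B' * (‖m‖ / (θBal F.L γ b₀ p₀ j / 4)) * (‖m'‖ / (θBal F.L γ b₀ p₀ j / 4))))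
∧ (∃ kV₃ : PBond (F.P j) 0 → PBond (F.P j) 0 → ℝ, (∀ B B', 0 ≤ kV₃ B B') ∧ (∀ B, ∑ B', kV₃ B B' * Real.exp (κ * (B.src.tdist B'.src : ℝ)) ≤ NV3 * ((((F.L : ℝ) ^ j / γ) * θBal F.L γ b₀ p₀ j ^ 2) / (((F.L : ℝ) ^ Ts / γ) * θBal F.L γ b₀ p₀ Ts ^ 2)) * w * (w / (((F.L : ℝ) ^ Ts / γ) * θBal F.L γ b₀ p₀ Ts ^ 2)) + δV3 j * (((F.L : ℝ) ^ j / γ) * θBal F.L γ b₀ p₀ j ^ 2)) ∧ (∀ B', ∑ B, kV₃ B B' * Real.exp (κ * (B.src.tdist B'.src : ℝ)) ≤ NV3 * ((((F.L : ℝ) ^ j / γ) * θBal F.L γ b₀ p₀ j ^ 2) / (((F.L : ℝ) ^ Ts / γ) * θBal F.L γ b₀ p₀ Ts ^ 2)) * w * (w / (((F.L : ℝ) ^ Ts / γ) * θBal F.L γ b₀ p₀ Ts ^ 2)) + δV3 j * (((F.L : ℝ) ^ j / γ) * θBal F.L γ b₀ p₀ j ^ 2)) ∧ ∀ t : ℝ,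 0 ≤ t → t ≤ 1 → (∀ (B B' : PBond (F.P j) 0) (m m' : Fin 3 → ℝ) (U₁ V₁ U₂ W₂ : GaugeField (F.P j) 0 ↥(Matrix.specialUnitaryGroup (Fin 2) ℂ)), ‖m‖ ≤ rc * (θBal F.L γ b₀ p₀ j / 4) → ‖m'‖ ≤ rc * (θBal F.L γ b₀ p₀ j / 4) → PlaqSmall (θBal F.L γ b₀ p₀ j / 4) U₁ → PlaqSmall (θBal F.L γ b₀ p₀ j / 4) V₁ → PlaqSmall (θBal F.L γ b₀ p₀ j / 4) U₂ → PlaqSmall (θBal F.L γ b₀ p₀ j / 4) W₂ → (∀ e, e ≠ B → V₁ e = U₁ e) → V₁ B = U₁ B * expPt m → (∀ e, e ≠ B' → W₂ e = U₂ e) → W₂ B' = U₂ B' * expPt m' → ∀ (c₁ e₁ c₂ e₂ : ℝ), c₁ = ∫ z, ((Real.log (ρ Ts (Φ (V₁, z))) - Real.log (ρ' Ts (Φ (V₁, z)))) - (Real.log (ρ Ts (Φ (U₁, z))) - Real.log (ρ' Ts (Φ (U₁, z))))) * (wgt F γ b₀ p₀ j Ts ρ ρ' τ Φ J t) W₂ z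 ∂τ → e₁ = ∫ z, ((Real.log (ρ Ts (Φ (V₁, z))) - Real.log (ρ' Ts (Φ (V₁, z)))) + (Real.log (ρ Ts (Φ (U₁, z))) - Real.log (ρ' Ts (Φ (U₁, z))))) * (wgt F γ b₀ p₀ j Ts ρ ρ' τ Φ J t) W₂ z ∂τ → c₂ = ∫ z, ((Real.log (ρ Ts (Φ (V₁, z))) - Real.log (ρ' Ts (Φ (V₁, z)))) - (Real.log (ρ Ts (Φ (U₁, z))) - Real.log (ρ' Ts (Φ (U₁, z))))) * (wgt F γ b₀ p₀ j Ts ρ ρ' τ Φ J t) U₂ z ∂τ → e₂ = ∫ z, ((Real.log (ρ Ts (Φ (V₁, z))) - Real.log (ρ' Ts (Φ (V₁, z)))) + (Real.log (ρ Ts (Φ (U₁, z))) - Real.log (ρ' Ts (Φ (U₁, z))))) * (wgt F γ b₀ p₀ j Ts ρ ρ' τ Φ J t) U₂ z ∂τ → Integrable (fun z => (((Real.log (ρ Ts (Φ (V₁, z))) - Real.log (ρ' Ts (Φ (V₁, z)))) - (Real.log (ρ Ts (Φ (U₁, z))) - Real.log (ρ' Ts (Φ (U₁, z))))) - c₁)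 * (((Real.log (ρ Ts (Φ (V₁, z))) - Real.log (ρ' Ts (Φ (V₁, z)))) + (Real.log (ρ Ts (Φ (U₁, z))) - Real.log (ρ' Ts (Φ (U₁, z))))) - e₁) * (wgt F γ b₀ p₀ j Ts ρ ρ' τ Φ J t) W₂ z) τ ∧ Integrable (fun z => (((Real.log (ρ Ts (Φ (V₁, z))) - Real.log (ρ' Ts (Φ (V₁, z)))) - (Real.log (ρ Ts (Φ (U₁, z))) - Real.log (ρ' Ts (Φ (U₁, z))))) - c₂) * (((Real.log (ρ Ts (Φ (V₁, z))) - Real.log (ρ' Ts (Φ (V₁, z)))) + (Real.log (ρ Ts (Φ (U₁, z))) - Real.log (ρ' Ts (Φ (U₁, z))))) - e₂) * (wgt F γ b₀ p₀ j Ts ρ ρ' τ Φ J t) U₂ z) τ ∧ |(∫ z, (((Real.log (ρ Ts (Φ (V₁, z))) - Real.log (ρ' Ts (Φ (V₁, z)))) - (Real.log (ρ Ts (Φ (U₁, z))) - Real.log (ρ' Ts (Φ (U₁, z))))) - c₁) * (((Real.log (ρ Ts (Φ (V₁, z))) - Real.log (ρ' Ts (Φ (V₁, z)))) + (Real.log (ρ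 Ts (Φ (U₁, z))) - Real.log (ρ' Ts (Φ (U₁, z))))) - e₁) * (wgt F γ b₀ p₀ j Ts ρ ρ' τ Φ J t) W₂ z ∂τ) - (∫ z, (((Real.log (ρ Ts (Φ (V₁, z))) - Real.log (ρ' Ts (Φ (V₁, z)))) - (Real.log (ρ Ts (Φ (U₁, z))) - Real.log (ρ' Ts (Φ (U₁, z))))) - c₂) * (((Real.log (ρ Ts (Φ (V₁, z))) - Real.log (ρ' Ts (Φ (V₁, z)))) + (Real.log (ρ Ts (Φ (U₁, z))) - Real.log (ρ' Ts (Φ (U₁, z))))) - e₂) * (wgt F γ b₀ p₀ j Ts ρ ρ' τ Φ J t) U₂ z ∂τ)| ≤ kV₃ B B' * (‖m‖ / (θBal F.L γ b₀ p₀ j / 4)) * (‖m'‖ / (θBal F.L γ b₀ p₀ j / 4))))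
∧ (∃ kV₄ : PBond (F.P j) 0 → PBond (F.P j) 0 → ℝ, (∀ B B', 0 ≤ kV₄ B B') ∧ (∀ B, ∑ B', kV₄ B B' * Real.exp (κ * (B.src.tdist B'.src : ℝ)) ≤ NV4 * ((((F.L : ℝ) ^ j / γ) * θBal F.L γ b₀ p₀ j ^ 2) / (((F.L : ℝ) ^ Ts / γ) * θBal F.L γ b₀ p₀ Ts ^ 2)) * w * (w / (((F.L : ℝ) ^ Ts / γ) * θBal F.L γ b₀ p₀ Ts ^ 2)) + δV4 j * (((F.L : ℝ) ^ j / γ) * θBal F.L γ b₀ p₀ j ^ 2)) ∧ ∀ t : ℝ, 0 ≤ t → t ≤ 1 → (∀ (B B' : PBond (F.P j) 0) (m m' : Fin 3 → ℝ) (V00 V10 V01 V11 : GaugeField (F.P j) 0 ↥(Matrix.specialUnitaryGroup (Fin 2) ℂ)), ‖m‖ ≤ rc * (θBal F.L γ b₀ p₀ j / 4) → ‖m'‖ ≤ rc * (θBal F.L γ b₀ p₀ j / 4) → PlaqSmall (θBal F.L γ b₀ p₀ j / 4) V00 → PlaqSmall (θBal F.L γ b₀ p₀ j / 4) V10 → PlaqSmall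 (θBal F.L γ b₀ p₀ j / 4) V01 → PlaqSmall (θBal F.L γ b₀ p₀ j / 4) V11 → (∀ e, e ≠ B → V10 e = V00 e) → V10 B = V00 B * expPt m → (∀ e, e ≠ B' → V01 e = V00 e) → V01 B' = V00 B' * expPt m' → (∀ e, e ≠ B' → V11 e = V10 e) → V11 B' = V10 B' * expPt m' → ∀ (c₀₀ c₁₀ c₀₁ c₁₁ : ℝ), c₀₀ = ∫ z, (Real.log (ρ Ts (Φ (V00, z))) - Real.log (ρ' Ts (Φ (V00, z)))) * (wgt F γ b₀ p₀ j Ts ρ ρ' τ Φ J t) V00 z ∂τ → c₁₀ = ∫ z, (Real.log (ρ Ts (Φ (V00, z))) - Real.log (ρ' Ts (Φ (V00, z)))) * (wgt F γ b₀ p₀ j Ts ρ ρ' τ Φ J t) V10 z ∂τ → c₀₁ = ∫ z, (Real.log (ρ Ts (Φ (V00, z))) - Real.log (ρ' Ts (Φ (V00, z)))) * (wgt F γ b₀ p₀ j Ts ρ ρ' τ Φ J t) V01 z ∂τ → c₁₁ = ∫ z, (Real.log (ρ Ts (Φ (V00, z))) - Real.log (ρ' Ts (Φ (V00, z)))) *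 (wgt F γ b₀ p₀ j Ts ρ ρ' τ Φ J t) V11 z ∂τ → Integrable (fun z => ((Real.log (ρ Ts (Φ (V00, z))) - Real.log (ρ' Ts (Φ (V00, z)))) - c₀₀) ^ 2 * (wgt F γ b₀ p₀ j Ts ρ ρ' τ Φ J t) V00 z) τ ∧ Integrable (fun z => ((Real.log (ρ Ts (Φ (V00, z))) - Real.log (ρ' Ts (Φ (V00, z)))) - c₁₀) ^ 2 * (wgt F γ b₀ p₀ j Ts ρ ρ' τ Φ J t) V10 z) τ ∧ Integrable (fun z => ((Real.log (ρ Ts (Φ (V00, z))) - Real.log (ρ' Ts (Φ (V00, z)))) - c₀₁) ^ 2 * (wgt F γ b₀ p₀ j Ts ρ ρ' τ Φ J t) V01 z) τ ∧ Integrable (fun z => ((Real.log (ρ Ts (Φ (V00, z))) - Real.log (ρ' Ts (Φ (V00, z)))) - c₁₁) ^ 2 * (wgt F γ b₀ p₀ j Ts ρ ρ' τ Φ J t) V11 z) τ ∧ |(∫ z, ((Real.log (ρ Ts (Φ (V00, z))) - Real.log (ρ' Ts (Φ (V00, z)))) - c₁₁) ^ 2 * (wgt F γ b₀ p₀ j Ts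 ρ ρ' τ Φ J t) V11 z ∂τ) - (∫ z, ((Real.log (ρ Ts (Φ (V00, z))) - Real.log (ρ' Ts (Φ (V00, z)))) - c₁₀) ^ 2 * (wgt F γ b₀ p₀ j Ts ρ ρ' τ Φ J t) V10 z ∂τ) - (∫ z, ((Real.log (ρ Ts (Φ (V00, z))) - Real.log (ρ' Ts (Φ (V00, z)))) - c₀₁) ^ 2 * (wgt F γ b₀ p₀ j Ts ρ ρ' τ Φ J t) V01 z ∂τ) + (∫ z, ((Real.log (ρ Ts (Φ (V00, z))) - Real.log (ρ' Ts (Φ (V00, z)))) - c₀₀) ^ 2 * (wgt F γ b₀ p₀ j Ts ρ ρ' τ Φ J t) V00 z ∂τ)| ≤ kV₄ B B' * (‖m‖ / (θBal F.L γ b₀ p₀ j / 4)) * (‖m'‖ / (θBal F.L γ b₀ p₀ j / 4)))))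

end Summit.QuantumFields.YangMills.Theorems.FluctuationComparisonRegPrIntLRunpairOrganFibreLawJ

end
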